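/-
Copyright: public-audit package `pub-balaban` (b2b-balaban), seat pv09-g4. Released under Apache 2.0 like Mathlib.
-/
import Literature.MathematicalPhysics.QuantumFieldTheory.Balaban1983to89.B6Lemma24PrintedShape
import Literature.MathematicalPhysics.QuantumFieldTheory.Balaban1983to89.B6LayerPoincarePair

/-!
# B6, Lemma 2.4: the chain (2.126) → (2.127)_κ → (2.128)_κ for an ARBITRARY layer constant κ, and the instance
κ₁ = 2/(2 + (d−1)(L−1)) of the sharp order 1/L

Source under audit: T. Bałaban, *Propagators and renormalization transformations for lattice gauge theories.
II*, Commun. Math. Phys. **96** (1984) 223–250 [B6], (2.126)–(2.128) and Lemma 2.4, p. 245.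

## What this file proves

The kernel-checked chain `B6FaceLowerBound.face2127` → `B6Lemma24Assembly.step2127` / `lemma24K` /
`lemma24_kappa0` → `B6Lemma24PrintedShape.lemma24_printedShape` was written with the layer constant κ₀ of
`B6LayerPoincare` hard-wired.  Its only κ-dependent input is the layer inequality (the repaired p.245 sentence).
Here the chain is re-run ONCE for an arbitrary constant κ satisfying that inequality (`LayerIneq d L κ`, §1):

* `face2127K` — (2.127)_κ per coarse bond; `sum_face2127K`; `step2127K` — `B6.Step2127 d L κ` for the concrete
  carrier (0 ≤ κ); `lemma24K_K` — `B6.Lemma24K d L κ` (κ ≤ 1); `lemma24_K` and the printed shape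
  `lemma24_printedShape_K` (Q₁ verbatim, (2.121) as printed, arbitrary finite carriers, `B6Lemma24PrintedShape`).
* Instances: κ₀ (`layerIneq_kappa0`, recovering the landed theorems) and **κ₁ = 2/(2 + (d−1)(L−1))**
  (`layerIneq_kappa1` = `B6LayerPoincarePair.layerPoincare1`): **`lemma24_kappa1`**, **`lemma24_printedShape_kappa1`**:
  (κ₁/(12d²)) L^{−d−1} ‖B‖² ≤ L^{d−2} Σ_{c∈Λ′}|(Q₁B)(c)|² + Σ_p|(∂₁B)(p)|² — Lemma 2.4 with the constant that
  the printed METHOD yields once its layer step is done at the right order: κ₁ has the sharp order 1/L FOR THE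
  LAYER INEQUALITY (exact layer constant κ_L = min{1, 4L sin²(π/2L)} ~ π²/L, `B6.kappaL`, not reached).  What is
  refuted in print for L ≥ 10 is the printed DERIVATION — the layer sentence and the displayed (2.127)
  (`B6.claim_p245_fails_L10`, `B6.ineq2127_fails_L10`; census G-B6-09/G-B6-09R); whether the printed
  L-independent constant 1/(12d²) of the STATEMENT (2.128) holds is decided neither here nor elsewhere in the
  package (numerically supported, unproved: census G-B6-09R, `HOME/b2b-balaban-r1` Lemma24-repair.md §0).
  (DOCFIX v1.1: v1, p181239, said here "the printed L-independent 1/(12d²) is false for L ≥ 10" — an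
  over-statement of the census, withdrawn.)
* `LayerIneq.mono`: the hypothesis is monotone in κ, so any future sharper layer lemma plugs in here.

HONEST SCOPE as in `B6Lemma24Assembly` / `B6Lemma24PrintedShape`: Z^d instead of the torus; the printed
constant is replaced, not verified; the tags name the displays whose repaired forms are proved.
-/

open Finset

namespace Literature.MathematicalPhysics.QuantumFieldTheory.Balaban1983to89.B6Lemma24Kappa

open B6Elimination (block mem_block)
open B6BondElimination (unitVec unitVec_apply add_unitVec_apply add_smul_unitVec_apply treeBonds contour)
open B6TreeGaugePoincare (Cfg curl innerBonds bondStarts)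
open B6FaceInterpolation (lastLayer firstLayer bondsIn mem_lastLayer ineq2124)
open B6LayerPoincare (gradSq kappa0 kappa0_pos kappa0_le_one layerPoincare)
open B6AveragingBound (ineq2125)
open B6Lemma24Carrier (lamBonds lamPlaq normSq d1Sq nIn pIn carrier split coarseBonds q1Term q1Of q1Of_nonneg
  lemma24K_of_step2127)
open B6FaceLowerBound (absorb_last absorb_first sq_rescale)
open B6Lemma24Assembly (faces_le_pCr crossing_cover sum_blockSq_minus_le sum_blockSq_plus_le)
open B6Lemma24PrintedShape (q1 q1Of_eq contourSum treeGauge_of_contour contourSum_eq_zero_of_bondwise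
  sum_sq_superset d1Sq_le_sum_superset sum_curlSq_superset q18 q18_eq_q1)
open B6LayerPoincarePair (kappa1 kappa1_pos kappa1_le_one layerPoincare1)
open B6 (Step2127 Lemma24K)

noncomputable section

variable {d : ℕ} {L : ℕ}

/-! ## §1  The layer hypothesis with constant κ -/

/-- The layer inequality on Δ′ with constant κ (the repaired form of the p.245 sentence): for every corner y,
direction μ and g : Z^d → ℝ, κ L^{−d−1} Σ_{x∈Δ′} g(x)² ≤ L^{−d} Σ_{b⊂Δ′}(g(b₊) − g(b₋))² + L^{−2}(L^{−(d−1)}Σ_{x∈Δ′} g(x))².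
Cf. the printed p.245 sentence «This quadratic form is bounded from below by L^{−d−1} Σ_{x∈Δ′} |B_μ(x)|², hence»,
printed with factor 1 and refuted for L ≥ 10 (`B6.claim_p245_fails_L10`); here κ is a free constant and `LayerIneq`
is used only as a hypothesis (instances: κ₀ `layerIneq_kappa0`, κ₁ `layerIneq_kappa1`).
[cite: Balaban1984PropagatorsII, p.245] -/
def LayerIneq (d L : ℕ) (κ : ℝ) : Prop :=
  ∀ (y : Fin d → ℤ) (μ : Fin d) (g : (Fin d → ℤ) → ℝ),
    κ * ((L : ℝ)⁻¹) ^ (d + 1) * ∑ x ∈ lastLayer L y μ, g x ^ 2 ≤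
      ((L : ℝ)⁻¹) ^ d * gradSq g (lastLayer L y μ) +
        ((L : ℝ)⁻¹) ^ 2 * (((L : ℝ)⁻¹) ^ (d - 1) * ∑ x ∈ lastLayer L y μ, g x) ^ 2

/-- κ₀ = 1/(4 + 6d(L−1)L^{d−2}) satisfies it (`B6LayerPoincare.layerPoincare`). [folklore] -/
theorem layerIneq_kappa0 (hd : 2 ≤ d) (hL : 1 ≤ L) : LayerIneq d L (kappa0 d L) :=
  fun y μ g => layerPoincare hd hL y μ g

/-- κ₁ = 2/(2 + (d−1)(L−1)) satisfies it (`B6LayerPoincarePair.layerPoincare1`). [folklore] -/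
theorem layerIneq_kappa1 (hd : 2 ≤ d) (hL : 1 ≤ L) : LayerIneq d L (kappa1 d L) :=
  fun y μ g => layerPoincare1 hd hL y μ g

/-- The hypothesis is monotone: it passes to every smaller constant. [folklore] -/
theorem LayerIneq.mono {κ κ' : ℝ} (h : κ' ≤ κ) (hκ : LayerIneq d L κ) : LayerIneq d L κ' := fun y μ g => by
  refine le_trans ?_ (hκ y μ g)
  have h0 : 0 ≤ ((L : ℝ)⁻¹) ^ (d + 1) * ∑ x ∈ lastLayer L y μ, g x ^ 2 :=
    mul_nonneg (by positivity) (sum_nonneg fun _ _ => sq_nonneg _)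
  calc κ' * ((L : ℝ)⁻¹) ^ (d + 1) * ∑ x ∈ lastLayer L y μ, g x ^ 2
      = κ' * (((L : ℝ)⁻¹) ^ (d + 1) * ∑ x ∈ lastLayer L y μ, g x ^ 2) := by ring
    _ ≤ κ * (((L : ℝ)⁻¹) ^ (d + 1) * ∑ x ∈ lastLayer L y μ, g x ^ 2) := mul_le_mul_of_nonneg_right h h0
    _ = _ := by ring

/-! ## §2  (2.127)_κ per coarse bond and its sum -/

/-- **(2.127)_κ for one coarse bond c = ⟨y, y + Le_μ⟩** (every configuration B; d ≥ 2, L ≥ 1, κ with `LayerIneq`):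
κ L^{−d−1} Σ_{x∈Δ′} B_μ(x)² − 3L^{−d}[Σ_{b⊂B(c₋)} B(b)² + Σ_{b⊂B(c₊)} B(b)²] ≤ 3[L^{−d} Σ_{b⊂Δ′}(∂₁B)(p(b))² + |(Q₁B)(c)|²]
— the proof of `B6FaceLowerBound.face2127` with the layer lemma as a hypothesis.
[cite: Balaban1984PropagatorsII, (2.126)–(2.127) p.245] -/
theorem face2127K (hd : 2 ≤ d) (hL : 1 ≤ L) {κ : ℝ} (hlayer : LayerIneq d L κ) (y : Fin d → ℤ) (μ : Fin d)
    (B : Cfg d) :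
    κ * ((L : ℝ)⁻¹) ^ (d + 1) * ∑ x ∈ lastLayer L y μ, B (x, μ) ^ 2
      - 3 * ((L : ℝ)⁻¹) ^ d *
        (∑ b ∈ innerBonds L y, B b ^ 2 + ∑ b ∈ innerBonds L (y + (L : ℤ) • unitVec μ), B b ^ 2) ≤
    3 * (((L : ℝ)⁻¹) ^ d * ∑ b ∈ bondsIn (lastLayer L y μ), curl B b.1 b.2 μ ^ 2 + q1Term L B (y, μ)) := by
  have h1 := ineq2124 hL y μ B
  have h2 := ineq2125 hL y μ B
  have h3 := hlayer y μ (fun z => B (z, μ))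
  simp only [gradSq] at h3
  rw [sq_rescale (by omega : 1 ≤ d)] at h3
  have h4 := absorb_last (L := L) y μ B
  have h5 := absorb_first (L := L) y μ B
  have hq : q1Term L B (y, μ) =
      (∑ x ∈ block L y, ((L : ℝ)⁻¹) ^ (d + 1) * ∑ t ∈ range L, B (x + (t : ℤ) • unitVec μ, μ)) ^ 2 := rfl
  have hℓ : (0 : ℝ) ≤ ((L : ℝ)⁻¹) ^ d := by positivity
  have h1' := mul_le_mul_of_nonneg_left h1 hℓ
  have h4' := mul_le_mul_of_nonneg_left h4 hℓ
  have h5' := mul_le_mul_of_nonneg_left h5 hℓ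
  rw [hq]
  linarith

/-- (2.127)_κ summed over the coarse bonds meeting Λ′ (as `B6Lemma24Assembly.sum_face2127`; the cell's
reconstruction of the unprinted passage (2.127) + (2.123) ⟹ (2.128), census G-B6-08; PRINT GIVES NO SUMMATION TEXT —
v1/v1.1 of this docstring carried a quoted fragment that is not in the paper, withdrawn here, GAPS G-pv24g3-1 /
C-pv09g4-20). [folklore] -/
theorem sum_face2127K (hd : 2 ≤ d) (hL : 1 ≤ L) {κ : ℝ} (hlayer : LayerIneq d L κ)
    (Λ' : Finset (Fin d → ℤ)) (B : Cfg d) :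
    κ * ((L : ℝ)⁻¹) ^ (d + 1) * ∑ c ∈ coarseBonds L Λ', ∑ x ∈ lastLayer L c.1 c.2, B (x, c.2) ^ 2
      - 3 * ((L : ℝ)⁻¹) ^ d * (∑ c ∈ coarseBonds L Λ', ∑ b ∈ innerBonds L c.1, B b ^ 2
          + ∑ c ∈ coarseBonds L Λ', ∑ b ∈ innerBonds L (c.1 + (L : ℤ) • unitVec c.2), B b ^ 2) ≤
    3 * (((L : ℝ)⁻¹) ^ d * ∑ c ∈ coarseBonds L Λ', ∑ b ∈ bondsIn (lastLayer L c.1 c.2), curl B b.1 b.2 c.2 ^ 2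
      + q1Of L Λ' B) := by
  have h := sum_le_sum fun c (_ : c ∈ coarseBonds L Λ') => face2127K hd hL hlayer c.1 c.2 B
  have e1 : ∑ c ∈ coarseBonds L Λ',
      (κ * ((L : ℝ)⁻¹) ^ (d + 1) * ∑ x ∈ lastLayer L c.1 c.2, B (x, c.2) ^ 2
        - 3 * ((L : ℝ)⁻¹) ^ d * (∑ b ∈ innerBonds L c.1, B b ^ 2
          + ∑ b ∈ innerBonds L (c.1 + (L : ℤ) • unitVec c.2), B b ^ 2)) =
      κ * ((L : ℝ)⁻¹) ^ (d + 1) * ∑ c ∈ coarseBonds L Λ', ∑ x ∈ lastLayer L c.1 c.2, B (x, c.2) ^ 2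
      - 3 * ((L : ℝ)⁻¹) ^ d * (∑ c ∈ coarseBonds L Λ', ∑ b ∈ innerBonds L c.1, B b ^ 2
          + ∑ c ∈ coarseBonds L Λ', ∑ b ∈ innerBonds L (c.1 + (L : ℤ) • unitVec c.2), B b ^ 2) := by
    rw [sum_sub_distrib, ← mul_sum, ← mul_sum, sum_add_distrib]
  have e2 : ∑ c ∈ coarseBonds L Λ',
      3 * (((L : ℝ)⁻¹) ^ d * ∑ b ∈ bondsIn (lastLayer L c.1 c.2), curl B b.1 b.2 c.2 ^ 2
        + q1Term L B (c.1, c.2)) =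
      3 * (((L : ℝ)⁻¹) ^ d * ∑ c ∈ coarseBonds L Λ', ∑ b ∈ bondsIn (lastLayer L c.1 c.2),
        curl B b.1 b.2 c.2 ^ 2 + q1Of L Λ' B) := by
    rw [← mul_sum, sum_add_distrib, ← mul_sum]
    rfl
  linarith [h, e1, e2]

/-! ## §3  `Step2127 d L κ`, `Lemma24K d L κ`, Lemma 2.4_κ and its printed shape -/

/-- **`B6.Step2127 d L κ` for the concrete carrier**, for every κ ≥ 0 satisfying the layer inequality
(d ≥ 2, L ≥ 1, Λ′ ⊂ LZ^d finite) — the proof of `B6Lemma24Assembly.step2127`, κ-generic.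
[cite: Balaban1984PropagatorsII, (2.127)–(2.128) p.245] -/
theorem step2127K (hd : 2 ≤ d) (hL : 1 ≤ L) {κ : ℝ} (hκ0 : 0 ≤ κ) (hlayer : LayerIneq d L κ)
    {Λ' : Finset (Fin d → ℤ)} (hΛ : ∀ y ∈ Λ', ∀ i, (L : ℤ) ∣ y i) :
    Step2127 d (L : ℝ) κ (carrier L Λ' (q1Of L Λ'))
      (split (Nat.lt_of_lt_of_le Nat.zero_lt_one hL) hΛ (q1Of L Λ') (q1Of_nonneg Λ')) := by
  intro B hB
  obtain ⟨hB0, -⟩ := hB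
  have hL0 : 0 < L := Nat.lt_of_lt_of_le Nat.zero_lt_one hL
  show κ * ((L : ℝ)⁻¹) ^ (d + 1) * (normSq L Λ' B - nIn L Λ' B)
      - 6 * (d : ℝ) * ((L : ℝ)⁻¹) ^ d * nIn L Λ' B ≤
    3 * (((L : ℝ)⁻¹) ^ d * (d1Sq L Λ' B - pIn L Λ' B) + q1Of L Λ' B)
  have hF := faces_le_pCr hL hΛ B
  have hC := crossing_cover hL0 hΛ B
  have hN1 := sum_blockSq_minus_le hL0 hΛ hB0
  have hN2 := sum_blockSq_plus_le hL0 hΛ hB0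
  have hsum := sum_face2127K hd hL hlayer Λ' B
  have hk : 0 ≤ κ * ((L : ℝ)⁻¹) ^ (d + 1) := mul_nonneg hκ0 (by positivity)
  have hℓ : 0 ≤ ((L : ℝ)⁻¹) ^ d := by positivity
  have h1 := mul_le_mul_of_nonneg_left hC hk
  have h2 := mul_le_mul_of_nonneg_left hF hℓ
  have h3 := mul_le_mul_of_nonneg_left (add_le_add hN1 hN2) hℓ
  linarith

/-- **`B6.Lemma24K d L κ` for every family of concrete carriers**, for every κ ∈ [0, 1] satisfying the layer
inequality. [cite: Balaban1984PropagatorsII, Lemma 2.4 (2.128) p.245] -/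
theorem lemma24K_K {I : Type} (hd : 2 ≤ d) (hL : 1 ≤ L) {κ : ℝ} (hκ0 : 0 ≤ κ) (hκ1 : κ ≤ 1)
    (hlayer : LayerIneq d L κ) (Λ' : I → Finset (Fin d → ℤ)) (hΛ : ∀ i, ∀ y ∈ Λ' i, ∀ j, (L : ℤ) ∣ y j) :
    Lemma24K d (L : ℝ) κ (fun i => carrier L (Λ' i) (q1Of L (Λ' i))) :=
  lemma24K_of_step2127 hd hL hκ1 Λ' hΛ (fun i => q1Of L (Λ' i)) (fun i => q1Of_nonneg (Λ' i))
    fun i => step2127K hd hL hκ0 hlayer (hΛ i)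

/-- **Lemma 2.4 with constant κ/(12d²)** for one region (tree-gauge form): for κ ∈ [0, 1] with `LayerIneq d L κ`,
every B with B = 0 outside Λ and the tree gauge in the blocks of Λ satisfies
(κ/(12d²)) L^{−(d+1)} ‖B‖² ≤ L^{d−2} Σ_c|(Q₁B)(c)|² + Σ_p|(∂₁B)(p)|². [cite: Balaban1984PropagatorsII, Lemma 2.4 (2.128) p.245] -/
theorem lemma24_K (hd : 2 ≤ d) (hL : 1 ≤ L) {κ : ℝ} (hκ0 : 0 ≤ κ) (hκ1 : κ ≤ 1) (hlayer : LayerIneq d L κ)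
    {Λ' : Finset (Fin d → ℤ)} (hΛ : ∀ y ∈ Λ', ∀ i, (L : ℤ) ∣ y i) (B : Cfg d)
    (hB0 : ∀ b, b ∉ lamBonds L Λ' → B b = 0) (hT : ∀ y ∈ Λ', ∀ b ∈ treeBonds L y, B b = 0) :
    κ / (12 * (d : ℝ) ^ 2) * (L : ℝ) ^ (-((d : ℝ) + 1)) * normSq L Λ' B ≤
      (L : ℝ) ^ ((d : ℝ) - 2) * q1Of L Λ' B + d1Sq L Λ' B :=
  lemma24K_K (I := Unit) hd hL hκ0 hκ1 hlayer (fun _ => Λ') (fun _ => hΛ) () B ⟨hB0, hT⟩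

/-- **Lemma 2.4_κ in the printed shape** (as `B6Lemma24PrintedShape.lemma24_printedShape`, κ-generic): Q₁ verbatim,
(2.121) as printed (contour sums), ‖B‖² and Σ_p over arbitrary finite carriers E ⊇ Λ-bonds, P ⊇ `lamPlaq`.
[cite: Balaban1984PropagatorsII, Lemma 2.4 (2.128) p.245] -/
theorem lemma24_printedShape_K (hd : 2 ≤ d) (hL : 1 ≤ L) {κ : ℝ} (hκ0 : 0 ≤ κ) (hκ1 : κ ≤ 1)
    (hlayer : LayerIneq d L κ) {Λ' : Finset (Fin d → ℤ)} (hΛ : ∀ y ∈ Λ', ∀ i, (L : ℤ) ∣ y i) (B : Cfg d)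
    (hB0 : ∀ b, b ∉ lamBonds L Λ' → B b = 0) (h2121 : ∀ y ∈ Λ', ∀ x ∈ block L y, contourSum L B y x = 0)
    {E : Finset ((Fin d → ℤ) × Fin d)} (hE : lamBonds L Λ' ⊆ E)
    {P : Finset ((Fin d → ℤ) × Fin d × Fin d)} (hP : lamPlaq L Λ' ⊆ P) :
    κ / (12 * (d : ℝ) ^ 2) * (L : ℝ) ^ (-((d : ℝ) + 1)) * ∑ b ∈ E, B b ^ 2 ≤
      (L : ℝ) ^ ((d : ℝ) - 2) * ∑ c ∈ coarseBonds L Λ', q1 L B c ^ 2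
        + ∑ p ∈ P, curl B p.1 p.2.1 p.2.2 ^ 2 := by
  have h := lemma24_K hd hL hκ0 hκ1 hlayer hΛ B hB0 fun y hy => treeGauge_of_contour (h2121 y hy)
  rw [sum_sq_superset hB0 hE, ← q1Of_eq]
  exact h.trans (add_le_add_right (d1Sq_le_sum_superset Λ' B hP) _)

/-! ## §4  The instance κ₁ = 2/(2 + (d−1)(L−1)) -/

/-- `B6.Step2127 d L κ₁` for the concrete carrier. [cite: Balaban1984PropagatorsII, (2.127)–(2.128) p.245] -/
theorem step2127_kappa1 (hd : 2 ≤ d) (hL : 1 ≤ L) {Λ' : Finset (Fin d → ℤ)}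
    (hΛ : ∀ y ∈ Λ', ∀ i, (L : ℤ) ∣ y i) :
    Step2127 d (L : ℝ) (kappa1 d L) (carrier L Λ' (q1Of L Λ'))
      (split (Nat.lt_of_lt_of_le Nat.zero_lt_one hL) hΛ (q1Of L Λ') (q1Of_nonneg Λ')) :=
  step2127K hd hL (kappa1_pos (by omega) hL).le (layerIneq_kappa1 hd hL) hΛ

/-- `B6.Lemma24K d L κ₁` for every family of concrete carriers. [cite: Balaban1984PropagatorsII, Lemma 2.4 (2.128) p.245] -/
theorem lemma24K_kappa1 {I : Type} (hd : 2 ≤ d) (hL : 1 ≤ L) (Λ' : I → Finset (Fin d → ℤ))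
    (hΛ : ∀ i, ∀ y ∈ Λ' i, ∀ j, (L : ℤ) ∣ y j) :
    Lemma24K d (L : ℝ) (kappa1 d L) (fun i => carrier L (Λ' i) (q1Of L (Λ' i))) :=
  lemma24K_K hd hL (kappa1_pos (by omega) hL).le (kappa1_le_one (by omega) hL) (layerIneq_kappa1 hd hL) Λ' hΛ

/-- **Lemma 2.4 with the constant κ₁/(12d²), κ₁ = 2/(2 + (d−1)(L−1))** (tree-gauge form): for d ≥ 2, L ≥ 1,
Λ′ ⊂ LZ^d finite, every B with B = 0 outside Λ and the tree gauge (2.121) in the blocks of Λ: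
(κ₁/(12d²)) L^{−(d+1)} ‖B‖² ≤ L^{d−2} Σ_c|(Q₁B)(c)|² + Σ_p|(∂₁B)(p)|² — the printed L-independent factor
1/(12d²) (whose printed derivation fails for L ≥ 10; itself unproved) replaced by κ₁/(12d²), κ₁ of the sharp
order 1/L for the layer step. [cite: Balaban1984PropagatorsII, Lemma 2.4 (2.128) p.245] -/
theorem lemma24_kappa1 (hd : 2 ≤ d) (hL : 1 ≤ L) {Λ' : Finset (Fin d → ℤ)}
    (hΛ : ∀ y ∈ Λ', ∀ i, (L : ℤ) ∣ y i) (B : Cfg d) (hB0 : ∀ b, b ∉ lamBonds L Λ' → B b = 0)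
    (hT : ∀ y ∈ Λ', ∀ b ∈ treeBonds L y, B b = 0) :
    kappa1 d L / (12 * (d : ℝ) ^ 2) * (L : ℝ) ^ (-((d : ℝ) + 1)) * normSq L Λ' B ≤
      (L : ℝ) ^ ((d : ℝ) - 2) * q1Of L Λ' B + d1Sq L Λ' B :=
  lemma24_K hd hL (kappa1_pos (by omega) hL).le (kappa1_le_one (by omega) hL) (layerIneq_kappa1 hd hL) hΛ B
    hB0 hT

/-- **Lemma 2.4 with κ₁ in the printed shape**: for d ≥ 2, L ≥ 1, Λ′ ⊂ LZ^d finite, B : bonds(Z^d) → ℝ with B = 0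
outside Λ and B(Γ_{y,x}) = 0 (x ∈ B(y), y ∈ Λ′), every finite E ⊇ Λ-bonds, P ⊇ `lamPlaq`:
(κ₁/(12d²)) L^{−(d+1)} Σ_{b∈E}|B(b)|² ≤ L^{d−2} Σ_{c∈Λ′}|(Q₁B)(c)|² + Σ_{p∈P}|(∂₁B)(p)|², (Q₁B)(c) as printed
((2.125)/(1.18)), κ₁ = 2/(2 + (d−1)(L−1)). [cite: Balaban1984PropagatorsII, Lemma 2.4 (2.128) p.245] -/
theorem lemma24_printedShape_kappa1 (hd : 2 ≤ d) (hL : 1 ≤ L) {Λ' : Finset (Fin d → ℤ)}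
    (hΛ : ∀ y ∈ Λ', ∀ i, (L : ℤ) ∣ y i) (B : Cfg d) (hB0 : ∀ b, b ∉ lamBonds L Λ' → B b = 0)
    (h2121 : ∀ y ∈ Λ', ∀ x ∈ block L y, contourSum L B y x = 0)
    {E : Finset ((Fin d → ℤ) × Fin d)} (hE : lamBonds L Λ' ⊆ E)
    {P : Finset ((Fin d → ℤ) × Fin d × Fin d)} (hP : lamPlaq L Λ' ⊆ P) :
    kappa1 d L / (12 * (d : ℝ) ^ 2) * (L : ℝ) ^ (-((d : ℝ) + 1)) * ∑ b ∈ E, B b ^ 2 ≤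
      (L : ℝ) ^ ((d : ℝ) - 2) * ∑ c ∈ coarseBonds L Λ', q1 L B c ^ 2
        + ∑ p ∈ P, curl B p.1 p.2.1 p.2.2 ^ 2 :=
  lemma24_printedShape_K hd hL (kappa1_pos (by omega) hL).le (kappa1_le_one (by omega) hL)
    (layerIneq_kappa1 hd hL) hΛ B hB0 h2121 hE hP

/-- The same with (2.121) in its bondwise printed form (p. 244) and the B5 (1.8) three-contour average in place of
Q₁ (they coincide under the hypotheses, `B6Lemma24PrintedShape.q18_eq_q1`).
[cite: Balaban1984PropagatorsII, (2.121) p.244, (2.128) p.245] -/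
theorem lemma24_printedShape18_kappa1 (hd : 2 ≤ d) (hL : 1 ≤ L) {Λ' : Finset (Fin d → ℤ)}
    (hΛ : ∀ y ∈ Λ', ∀ i, (L : ℤ) ∣ y i) (B : Cfg d) (hB0 : ∀ b, b ∉ lamBonds L Λ' → B b = 0)
    (h2121 : ∀ y ∈ Λ', ∀ x ∈ block L y, ∀ b ∈ contour L y x, B b = 0)
    {E : Finset ((Fin d → ℤ) × Fin d)} (hE : lamBonds L Λ' ⊆ E)
    {P : Finset ((Fin d → ℤ) × Fin d × Fin d)} (hP : lamPlaq L Λ' ⊆ P) :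
    kappa1 d L / (12 * (d : ℝ) ^ 2) * (L : ℝ) ^ (-((d : ℝ) + 1)) * ∑ b ∈ E, B b ^ 2 ≤
      (L : ℝ) ^ ((d : ℝ) - 2) * ∑ c ∈ coarseBonds L Λ', q18 L B c ^ 2
        + ∑ p ∈ P, curl B p.1 p.2.1 p.2.2 ^ 2 := by
  have hL0 : 0 < L := Nat.lt_of_lt_of_le Nat.zero_lt_one hL
  have hc : ∀ y ∈ Λ', ∀ x ∈ block L y, contourSum L B y x = 0 :=
    fun y hy => contourSum_eq_zero_of_bondwise (h2121 y hy)
  have hT : ∀ y ∈ Λ', ∀ b ∈ treeBonds L y, B b = 0 := fun y hy => treeGauge_of_contour (hc y hy)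
  have e : ∑ c ∈ coarseBonds L Λ', q18 L B c ^ 2 = ∑ c ∈ coarseBonds L Λ', q1 L B c ^ 2 :=
    sum_congr rfl fun c hc' => by rw [q18_eq_q1 hL0 hΛ hB0 hT hc']
  rw [e]
  exact lemma24_printedShape_kappa1 hd hL hΛ B hB0 hc hE hP

end

end Literature.MathematicalPhysics.QuantumFieldTheory.Balaban1983to89.B6Lemma24Kappa
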